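import Summits.AtomisticToContinuum.FouriersLaw.Theorems.BondHeatUncertaintyBoundedResponseEnergyFluctuation
import Summits.AtomisticToContinuum.FouriersLaw.Theorems.BondHeatUncertaintyBoundedResponseCommittorCorner
import Summits.AtomisticToContinuum.FouriersLaw.Theorems.PhononMeanFreePathIncoherentBoundedLeftEnergyDynkin
import HarnessLib

/-!
(SPLIT FOR THE 400-LINE CAP by the landing lane, hand-2 g37: this file = part 1 of 2 (§W.1 the position gradient of the block energy, §W.2 its extensive Dirichlet form); the sequel `…BoundedResponseBlockEnergyVariance` (§W.3 extensive variance, §W.4 `(W)` holds, §W.5 consequences) imports it; the module docstring stays here; same namespace / section / opens / variables, all FQNs unchanged.)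
# Bond-heat uncertainty — bounded response: (W) extensive static block-energy variances

Route `BondHeatUncertainty` (summit `AtomisticToContinuum`, sub-problem `FouriersLaw`), item
`BoundedResponse`; residual programme of `…BoundedResponseTransientContactBudget.lean` (piece (W)) and
of `…BoundedResponseCommittorCorner` (where (W) is the only hypothesis of the equivalence
`CorrectorGrade 1 ⟺ CurrentCorrectorBudget 3`; §W.5 below discharges it: ★ `correctorGrade_one_iff_budget_three`,
`CorrectorGrade 1 ↔ CurrentCorrectorBudget 3` OUTRIGHT, and `ConeScaleCorrector → CorrectorGrade 1`,
`LeakPoint → ConeScaleCorrector → BoundedResponse`).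

We PROVE the static statement

  `ExtensiveBlockEnergyVariance`:
  for `P = pinnedChain ω₂ λ β γ` (all `> 0`), `T > 0` there is `C` with, for every `N`, every bond `b`
  (`b + 1 < N`): `E_{≤b}, E_{>b} ∈ L²(μ_T)` and `Var_{μ_T}(E_{≤b}), Var_{μ_T}(E_{>b}) ≤ C·N`,

with the explicit constant `C = 2·C_H + 2·(T² + (T/ω₂)·K₁)`, `K₁ = 3K₀(1 + c + 90c³)`, `c = T/ω₂`,
`K₀ = gradConst ω₂ λ β`, `C_H` the constant of `EnergyFluctuationExtensive` (file
`…BoundedResponseEnergyFluctuation`).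

## Proof (Brascamp–Lieb for the block, exactly as for the full energy in §(V))

* Split `E_{≤b}(q,p) = ∑ₖ [k ≤ b] pₖ²/2 + U_{≤b}(q)` with `U_{≤b}(q) = E_{≤b}(q, 0)`,
  `0 ≤ U_{≤b} ≤ U_N`; hence `E_{≤b} − m = (∑ₖ [k ≤ b] θₖ)/2 + (U_{≤b} − c)`, `θₖ = pₖ² − T`.
* Kinetic covariance by the Gaussian integration by parts in `p_i` (the tree's
  `IncoherentBounded.integral_kinObs_mul_leftEnergy`: `∫ θ_i E_{≤b} dμ_T = [i ≤ b]·T²`), so the kinetic part of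
  the variance is `(T²/2)·#{k ≤ b} ≤ N T²/2`.
* Potential covariance `≤ ½Var(E_{≤b}) + ½Var_w(U_{≤b})`, and by the Brascamp–Lieb/Poincaré inequality of
  the log-concave position weight `w = e^{−U_N/T}` (`potWeight_poincare`):
  `Var_w(U_{≤b}) ≤ (T/ω₂) ∫ |∇U_{≤b}|² w / Z ≤ (T/ω₂)·K₁·N`, because the closed form
  `∂ₖU_{≤b} = [k ≤ b]U'(qₖ) + w_{k−1}V'(qₖ − qₖ₋₁) − wₖV'(qₖ₊₁ − qₖ)` (weights in `[0,1]`) obeys the same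
  per-site bound `(∂ₖU_{≤b})² ≤ K₀(Λ(qₖ) + Λ(qₖ₋₁) + Λ(qₖ₊₁))`, `Λ(s) = 1 + s² + s⁶`, as `∂ₖU_N`.
* `E_{>b} = H − E_{≤b}`: `Var ≤ 2Var H + 2Var E_{≤b}` and (V).

All constants are uniform in the bond `b` and in `N`.  No new definitions.

References: Brascamp–Lieb 1976 (Thm 4.1) [cite: BrascampLieb1976];
Bonetto–Lebowitz–Rey-Bellet 2000 §5.2 (block energies) [cite: BonettoLebowitzReyBellet2000].
-/

noncomputable section

open MeasureTheory ProbabilityTheory Finset Filter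
open Literature.MathematicalPhysics.KineticTheory
open Literature.MathematicalPhysics.KineticTheory.HeatConduction
open Literature.MathematicalPhysics.KineticTheory.HeatConduction.HardTether

namespace Summit.AtomisticToContinuum.FouriersLaw.Theorems.BoundedResponse.ParityFloor

section BlockEnergyVariance

open BoundaryKubo.GibbsTtcf TransientContact
open Summit.AtomisticToContinuum.FouriersLaw.Theorems.SubdiffusiveBondHeat.EscapeGrading (CurrentCorrectorBudget)
open Summit.AtomisticToContinuum.FouriersLaw.Theorems.SubdiffusiveBondHeat.CorrectorBudget (KineticCorrectorBudget)
open Summit.AtomisticToContinuum.FouriersLaw.Theses.OddSectorIrreversibility (ConeScaleCorrector)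
open Summit.AtomisticToContinuum.FouriersLaw.Theses.BondHeatUncertainty (BoundedResponse)

variable {ω₂ lam β γ T : ℝ} {N : ℕ}

/-! ## §W.1 The position gradient of the block energy in closed form -/

/-- Closed form of `∂E_{≤b}/∂q_k`:
`[k ≤ b]·U'(q_k) + w_{k−1}·V'(q_k − q_{k−1}) − w_k·V'(q_{k+1} − q_k)` (`w = bondWeight b`, boundary terms
absent). [folklore] -/
theorem dLeftEnergyQ_eq_closed (P : OscillatorChain) (b k : Fin N) (q : Fin N → ℝ) :
    dLeftEnergyQ P N b k q = blockWeight b k * deriv P.U (q k)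
      + (if h : 0 < k.val then
          bondWeight b ⟨k.val - 1, by omega⟩ * deriv P.V (q k - q ⟨k.val - 1, by omega⟩) else 0)
      - (if h : k.val + 1 < N then bondWeight b k * deriv P.V (q ⟨k.val + 1, h⟩ - q k) else 0) := by
  unfold dLeftEnergyQ
  rw [add_sub_assoc]
  congr 1
  have hsplit : ∀ k' l : Fin N, (if l.val = k'.val + 1 then
      bondWeight b k' * deriv P.V (q l - q k') * ((if l = k then 1 else 0) - (if k' = k then 1 else 0))
        else (0 : ℝ)) =
      (if l.val = k'.val + 1 ∧ l = k then bondWeight b k' * deriv P.V (q l - q k') else 0) -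
        (if l.val = k'.val + 1 ∧ k' = k then bondWeight b k' * deriv P.V (q l - q k') else 0) := by
    intro k' l
    by_cases h1 : l.val = k'.val + 1
    · by_cases h2 : l = k
      · have h3 : k' ≠ k := by
          intro h3; rw [h2, h3] at h1; omega
        simp [h2, h3]
      · by_cases h3 : k' = k
        · simp [h1, h2, h3]
        · simp [h1, h2, h3]
    · simp [h1]
  simp_rw [hsplit, Finset.sum_sub_distrib]
  congr 1
  · rw [Finset.sum_comm]
    rw [Finset.sum_eq_single k (fun l _ hl => by simp [hl]) (by simp)]
    by_cases hk : 0 < k.val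
    · rw [dif_pos hk]
      rw [Finset.sum_eq_single (⟨k.val - 1, by omega⟩ : Fin N)]
      · rw [if_pos ⟨by show k.val = (k.val - 1) + 1; omega, rfl⟩]
      · intro k' _ hk'
        rw [if_neg]
        rintro ⟨h1, -⟩
        apply hk'
        ext; simp only; omega
      · simp
    · rw [dif_neg hk]
      refine Finset.sum_eq_zero fun k' _ => ?_
      rw [if_neg]
      rintro ⟨h1, -⟩
      omega
  · rw [Finset.sum_eq_single k (fun k' _ hk' => by simp [hk']) (by simp)]
    by_cases hk : k.val + 1 < N
    · rw [dif_pos hk]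
      rw [Finset.sum_eq_single (⟨k.val + 1, hk⟩ : Fin N)]
      · simp
      · intro l _ hl
        rw [if_neg]
        rintro ⟨h1, -⟩
        apply hl
        ext; simp only; omega
      · simp
    · rw [dif_neg hk]
      refine Finset.sum_eq_zero fun l _ => ?_
      rw [if_neg]
      rintro ⟨h1, -⟩
      omega

/-- A weight in `[0, 1]` does not increase a square. [formal bookkeeping] -/
theorem sq_unitWeight_mul_le {w f : ℝ} (hw : 0 ≤ w ∧ w ≤ 1) : (w * f) ^ 2 ≤ f ^ 2 := by
  have hw1 : w ^ 2 ≤ 1 := by nlinarith [hw.1, hw.2]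
  rw [mul_pow]
  nlinarith [hw1, sq_nonneg f]

/-- **Per-site gradient bound for the block**: `(∂ₖU_{≤b})² ≤ K₀·(Λ(qₖ) + [0<k]Λ(qₖ₋₁) + [k+1<N]Λ(qₖ₊₁))`
— the same bound as for `∂ₖU_N` (`sq_coordDeriv_potEnergy_le`), the weights being in `[0,1]`. [folklore] -/
theorem sq_dLeftEnergyQ_le (b k : Fin N) (q : Fin N → ℝ) :
    dLeftEnergyQ (pinnedChain ω₂ lam β γ) N b k q ^ 2 ≤
      gradConst ω₂ lam β * (sitePoly (q k)
        + (if h : 0 < k.val then sitePoly (q ⟨k.val - 1, by omega⟩) else 0)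
        + (if h : k.val + 1 < N then sitePoly (q ⟨k.val + 1, h⟩) else 0)) := by
  rw [dLeftEnergyQ_eq_closed]
  simp only [pinnedChain_deriv_U, pinnedChain_deriv_V]
  set a : ℝ := blockWeight b k * (ω₂ * q k + lam * q k ^ 3) with ha
  set A : ℝ := (if h : 0 < k.val then bondWeight b ⟨k.val - 1, by omega⟩ *
      ((q k - q ⟨k.val - 1, by omega⟩) + β * (q k - q ⟨k.val - 1, by omega⟩) ^ 3) else 0) with hA
  set B : ℝ := (if h : k.val + 1 < N then bondWeight b k *
      ((q ⟨k.val + 1, h⟩ - q k) + β * (q ⟨k.val + 1, h⟩ - q k) ^ 3) else 0) with hB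
  set LA : ℝ := (if h : 0 < k.val then sitePoly (q ⟨k.val - 1, by omega⟩) else 0) with hLA
  set LB : ℝ := (if h : k.val + 1 < N then sitePoly (q ⟨k.val + 1, h⟩) else 0) with hLB
  have hL0 : 0 ≤ sitePoly (q k) := sitePoly_nonneg _
  have hLA0 : 0 ≤ LA := by rw [hLA]; split_ifs <;> simp [sitePoly_nonneg]
  have hLB0 : 0 ≤ LB := by rw [hLB]; split_ifs <;> simp [sitePoly_nonneg]
  have hκ : 0 ≤ ω₂ ^ 2 + lam ^ 2 := by positivity
  have hb : 0 ≤ 4 + 64 * β ^ 2 := by positivity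
  have h3 := sq_add_sub_le_three a A B
  have ha2 : a ^ 2 ≤ 2 * (ω₂ ^ 2 + lam ^ 2) * sitePoly (q k) :=
    (sq_unitWeight_mul_le (blockWeight_nonneg_le_one b k)).trans (sq_pinForce_le (q k))
  have hA2 : A ^ 2 ≤ (4 + 64 * β ^ 2) * (sitePoly (q k) + LA) := by
    rw [hA, hLA]
    by_cases h : 0 < k.val
    · simp only [h, dite_true]
      exact (sq_unitWeight_mul_le (bondWeight_nonneg_le_one _ _)).trans (sq_bondForce_le _ _)
    · simp only [h, dite_false]
      nlinarith [hb, hL0]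
  have hB2 : B ^ 2 ≤ (4 + 64 * β ^ 2) * (sitePoly (q k) + LB) := by
    rw [hB, hLB]
    by_cases h : k.val + 1 < N
    · simp only [h, dite_true]
      have := sq_bondForce_le (β := β) (q ⟨k.val + 1, h⟩) (q k)
      have hw := sq_unitWeight_mul_le (f := (q ⟨k.val + 1, h⟩ - q k) + β * (q ⟨k.val + 1, h⟩ - q k) ^ 3)
        (bondWeight_nonneg_le_one b k)
      nlinarith [this, hw]
    · simp only [h, dite_false]
      nlinarith [hb, hL0]
  unfold gradConst
  nlinarith [h3, ha2, hA2, hB2, hL0, hLA0, hLB0, hκ, hb, mul_nonneg hb hLA0, mul_nonneg hb hLB0,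
    mul_nonneg hκ hLA0, mul_nonneg hκ hLB0, mul_nonneg (sq_nonneg β) hLA0, mul_nonneg (sq_nonneg β) hLB0,
    mul_nonneg (sq_nonneg β) hL0]

/-- `∂ₖU_{≤b}` is continuous (a polynomial). [folklore] -/
theorem continuous_dLeftEnergyQ (b k : Fin N) :
    Continuous fun q => dLeftEnergyQ (pinnedChain ω₂ lam β γ) N b k q := by
  simp only [dLeftEnergyQ_eq_closed, pinnedChain_deriv_U, pinnedChain_deriv_V]
  by_cases h1 : 0 < k.val <;> by_cases h2 : k.val + 1 < N <;> simp only [h1, h2, dite_true, dite_false] <;>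
    fun_prop

/-- The pinning and interaction potentials of `pinnedChain` are nonnegative (`ω₂, λ, β ≥ 0`). [folklore] -/
theorem pinnedChain_U_V_nonneg (hω : 0 ≤ ω₂) (hl : 0 ≤ lam) (hβ : 0 ≤ β) :
    (∀ s, 0 ≤ (pinnedChain ω₂ lam β γ).U s) ∧ (∀ r, 0 ≤ (pinnedChain ω₂ lam β γ).V r) := by
  refine ⟨fun s => ?_, fun r => ?_⟩
  · show 0 ≤ ω₂ * s ^ 2 / 2 + lam * s ^ 4 / 4; positivity
  · show 0 ≤ r ^ 2 / 2 + β * r ^ 4 / 4; positivity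

/-- `∂ₖ` of the position part `U_{≤b}(q) = E_{≤b}(q, 0)` is `dLeftEnergyQ`. [folklore] -/
theorem coordDeriv_leftEnergy_zero (b k : Fin N) (q : Fin N → ℝ) :
    coordDeriv k (fun q : Fin N → ℝ => leftEnergy (pinnedChain ω₂ lam β γ) N b (q, fun _ => 0)) q =
      dLeftEnergyQ (pinnedChain ω₂ lam β γ) N b k q := by
  have hUd : Differentiable ℝ (pinnedChain ω₂ lam β γ).U :=
    (pinnedChain_contDiff_U ω₂ lam β γ (n := 1)).differentiable one_ne_zero
  have hVd : Differentiable ℝ (pinnedChain ω₂ lam β γ).V :=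
    (pinnedChain_contDiff_V ω₂ lam β γ (n := 1)).differentiable one_ne_zero
  exact (hasDerivAt_leftEnergy_updateQ _ hUd hVd b k ((q, fun _ => 0) : PhaseSpace N)).deriv

/-- `0 ≤ U_{≤b}(q) ≤ U_N(q)` and `0 ≤ E_{≤b} ≤ H`. [folklore] -/
theorem leftEnergy_zero_nonneg_le (hω : 0 ≤ ω₂) (hl : 0 ≤ lam) (hβ : 0 ≤ β) (b : Fin N) :
    (∀ q : Fin N → ℝ, 0 ≤ leftEnergy (pinnedChain ω₂ lam β γ) N b (q, fun _ => 0) ∧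
      leftEnergy (pinnedChain ω₂ lam β γ) N b (q, fun _ => 0) ≤ potEnergy ω₂ lam β N q) ∧
    (∀ x : PhaseSpace N, 0 ≤ leftEnergy (pinnedChain ω₂ lam β γ) N b x ∧
      leftEnergy (pinnedChain ω₂ lam β γ) N b x ≤ (pinnedChain ω₂ lam β γ).hamiltonian N x) := by
  obtain ⟨hU0, hV0⟩ := pinnedChain_U_V_nonneg (γ := γ) hω hl hβ
  refine ⟨fun q => ⟨leftEnergy_nonneg _ hU0 hV0 N b _, ?_⟩,
    fun x => ⟨leftEnergy_nonneg _ hU0 hV0 N b _, leftEnergy_le_hamiltonian _ hU0 hV0 N b _⟩⟩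
  refine (leftEnergy_le_hamiltonian _ hU0 hV0 N b _).trans_eq ?_
  rw [hamiltonian_eq_kin_add_potEnergy]
  simp

/-- **Kinetic/position split of the block energy**: `E_{≤b}(q,p) = ∑ₖ [k ≤ b] pₖ²/2 + E_{≤b}(q, 0)`.
[folklore] -/
theorem leftEnergy_eq_kin_add_zero (P : OscillatorChain) (b : Fin N) (x : PhaseSpace N) :
    leftEnergy P N b x = (∑ k, blockWeight b k * (x.2 k ^ 2 / 2)) + leftEnergy P N b (x.1, fun _ => 0) := by
  unfold leftEnergy
  simp only [mul_add, Finset.sum_add_distrib]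
  simp only [ne_eq, OfNat.ofNat_ne_zero, not_false_eq_true, zero_pow, zero_div, mul_zero,
    Finset.sum_const_zero, zero_add]
  ring

/-! ## §W.2 The Dirichlet form of `U_{≤b}` is extensive -/

/-- Per site: `(∂ₖU_{≤b})² w ∈ L¹` and `∫ (∂ₖU_{≤b})² w ≤ 3K₀(1 + c + 90c³)·Z`, uniformly in `k, b, N`.
[cite: BrascampLieb1976, Thm 4.1] -/
theorem integral_sq_dLeftEnergyQ_le (hω : 0 < ω₂) (hl : 0 ≤ lam) (hβ : 0 ≤ β) (hT : 0 < T)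
    (b k : Fin N) :
    Integrable (fun q => dLeftEnergyQ (pinnedChain ω₂ lam β γ) N b k q ^ 2 * potWeight ω₂ lam β T N q) ∧
    ∫ q, dLeftEnergyQ (pinnedChain ω₂ lam β γ) N b k q ^ 2 * potWeight ω₂ lam β T N q ≤
      3 * gradConst ω₂ lam β * (1 + T / ω₂ + 90 * (T / ω₂) ^ 3) * ∫ q, potWeight ω₂ lam β T N q := by
  set cΛ : ℝ := 1 + T / ω₂ + 90 * (T / ω₂) ^ 3 with hcΛ
  set Z : ℝ := ∫ q, potWeight ω₂ lam β T N q with hZ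
  have hZ0 : 0 < Z := integral_potWeight_pos hω hl hβ hT
  have hc0 : 0 ≤ cΛ := by have := div_pos hT hω; positivity
  have hK := gradConst_nonneg (ω₂ := ω₂) (lam := lam) (β := β)
  set G : (Fin N → ℝ) → ℝ := fun q => gradConst ω₂ lam β * (sitePoly (q k)
        + (if h : 0 < k.val then sitePoly (q ⟨k.val - 1, by omega⟩) else 0)
        + (if h : k.val + 1 < N then sitePoly (q ⟨k.val + 1, h⟩) else 0)) with hG
  have hSi := integral_sitePoly_mul_potWeight_le (N := N) hω hl hβ hT
  have hGA : Integrable (fun q => (if h : 0 < k.val then sitePoly (q ⟨k.val - 1, by omega⟩) else (0:ℝ)) *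
      potWeight ω₂ lam β T N q) ∧
      ∫ q, (if h : 0 < k.val then sitePoly (q ⟨k.val - 1, by omega⟩) else (0:ℝ)) * potWeight ω₂ lam β T N q
        ≤ cΛ * Z := by
    by_cases h : 0 < k.val
    · simp only [h, dite_true]; exact hSi _
    · simp only [h, dite_false, zero_mul, integral_zero]
      exact ⟨integrable_zero _ _ _, by positivity⟩
  have hGB : Integrable (fun q => (if h : k.val + 1 < N then sitePoly (q ⟨k.val + 1, h⟩) else (0:ℝ)) *
      potWeight ω₂ lam β T N q) ∧
      ∫ q, (if h : k.val + 1 < N then sitePoly (q ⟨k.val + 1, h⟩) else (0:ℝ)) * potWeight ω₂ lam β T N q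
        ≤ cΛ * Z := by
    by_cases h : k.val + 1 < N
    · simp only [h, dite_true]; exact hSi _
    · simp only [h, dite_false, zero_mul, integral_zero]
      exact ⟨integrable_zero _ _ _, by positivity⟩
  have hGI : Integrable (fun q => G q * potWeight ω₂ lam β T N q) := by
    have := (((hSi k).1.add hGA.1).add hGB.1).const_mul (gradConst ω₂ lam β)
    refine this.congr (Eventually.of_forall fun q => ?_)
    simp only [hG, Pi.add_apply]
    ring
  have hGint : ∫ q, G q * potWeight ω₂ lam β T N q ≤ 3 * gradConst ω₂ lam β * cΛ * Z := by
    have hA := integral_add (hSi k).1 hGA.1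
    have hB := integral_add ((hSi k).1.add hGA.1) hGB.1
    simp only [Pi.add_apply] at hB
    rw [hA] at hB
    have e : ∫ q, G q * potWeight ω₂ lam β T N q = gradConst ω₂ lam β *
        ∫ q, (sitePoly (q k) * potWeight ω₂ lam β T N q
          + (if h : 0 < k.val then sitePoly (q ⟨k.val - 1, by omega⟩) else (0:ℝ)) *
              potWeight ω₂ lam β T N q)
          + (if h : k.val + 1 < N then sitePoly (q ⟨k.val + 1, h⟩) else (0:ℝ)) *
              potWeight ω₂ lam β T N q := by
      rw [← integral_const_mul]
      refine integral_congr_ae (Eventually.of_forall fun q => ?_)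
      simp only [hG]
      ring
    rw [e, hB]
    nlinarith [(hSi k).2, hGA.2, hGB.2, hK]
  have hle : ∀ q, dLeftEnergyQ (pinnedChain ω₂ lam β γ) N b k q ^ 2 * potWeight ω₂ lam β T N q ≤
      G q * potWeight ω₂ lam β T N q := fun q =>
    mul_le_mul_of_nonneg_right (sq_dLeftEnergyQ_le b k q) (potWeight_pos _ _ _ _ _ _).le
  have hI : Integrable (fun q => dLeftEnergyQ (pinnedChain ω₂ lam β γ) N b k q ^ 2 *
      potWeight ω₂ lam β T N q) := by
    refine hGI.mono' (((continuous_dLeftEnergyQ b k).pow 2).mul continuous_potWeight).aestronglyMeasurable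
      (Eventually.of_forall fun q => ?_)
    rw [Real.norm_eq_abs, abs_of_nonneg (mul_nonneg (sq_nonneg _) (potWeight_pos _ _ _ _ _ _).le)]
    exact hle q
  exact ⟨hI, (integral_mono hI hGI hle).trans hGint⟩

/-- **Dirichlet form of `U_{≤b}` is extensive**: `∑ₖ(∂ₖU_{≤b})² w ∈ L¹` and
`∫ (∑ₖ(∂ₖU_{≤b})²) w ≤ N·K₁·Z`, `K₁ = 3K₀(1 + c + 90c³)`, uniformly in `b`. [cite: BrascampLieb1976, Thm 4.1] -/
theorem integral_sum_sq_coordDeriv_leftEnergy_le (hω : 0 < ω₂) (hl : 0 ≤ lam) (hβ : 0 ≤ β) (hT : 0 < T)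
    (b : Fin N) :
    Integrable (fun q => (∑ k, coordDeriv k
        (fun q : Fin N → ℝ => leftEnergy (pinnedChain ω₂ lam β γ) N b (q, fun _ => 0)) q ^ 2) *
        potWeight ω₂ lam β T N q) ∧
    ∫ q, (∑ k, coordDeriv k
        (fun q : Fin N → ℝ => leftEnergy (pinnedChain ω₂ lam β γ) N b (q, fun _ => 0)) q ^ 2) *
        potWeight ω₂ lam β T N q ≤
      (N : ℝ) * (3 * gradConst ω₂ lam β * (1 + T / ω₂ + 90 * (T / ω₂) ^ 3)) *
        ∫ q, potWeight ω₂ lam β T N q := by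
  simp only [coordDeriv_leftEnergy_zero]
  have h := fun k => integral_sq_dLeftEnergyQ_le (N := N) (γ := γ) hω hl hβ hT b k
  have hI : Integrable (fun q => ∑ k, dLeftEnergyQ (pinnedChain ω₂ lam β γ) N b k q ^ 2 *
      potWeight ω₂ lam β T N q) :=
    integrable_finsetSum _ (fun k _ => (h k).1)
  have e : (fun q => (∑ k, dLeftEnergyQ (pinnedChain ω₂ lam β γ) N b k q ^ 2) * potWeight ω₂ lam β T N q) =
      fun q => ∑ k, dLeftEnergyQ (pinnedChain ω₂ lam β γ) N b k q ^ 2 * potWeight ω₂ lam β T N q :=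
    funext fun q => Finset.sum_mul _ _ _
  rw [e]
  refine ⟨hI, ?_⟩
  rw [integral_finsetSum _ (fun k _ => (h k).1)]
  calc ∑ k, ∫ q, dLeftEnergyQ (pinnedChain ω₂ lam β γ) N b k q ^ 2 * potWeight ω₂ lam β T N q
      ≤ ∑ _k : Fin N, 3 * gradConst ω₂ lam β * (1 + T / ω₂ + 90 * (T / ω₂) ^ 3) *
          ∫ q, potWeight ω₂ lam β T N q := Finset.sum_le_sum fun k _ => (h k).2
    _ = _ := by
        rw [Finset.sum_const, Finset.card_univ, Fintype.card_fin, nsmul_eq_mul]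
        ring

/-- `U_{≤b} w, U_{≤b}² w ∈ L¹` (domination by `U_N`). [folklore] -/
theorem integrable_leftEnergy_zero_mul_potWeight (hω : 0 < ω₂) (hl : 0 ≤ lam) (hβ : 0 ≤ β) (hT : 0 < T)
    (b : Fin N) :
    Integrable (fun q => leftEnergy (pinnedChain ω₂ lam β γ) N b (q, fun _ => 0) * potWeight ω₂ lam β T N q) ∧
    Integrable (fun q => leftEnergy (pinnedChain ω₂ lam β γ) N b (q, fun _ => 0) ^ 2 *
      potWeight ω₂ lam β T N q) := by
  have h0 := fun q => potEnergy_nonneg hω.le hl hβ (N := N) q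
  have hE := (leftEnergy_zero_nonneg_le (γ := γ) (N := N) hω.le hl hβ b).1
  have hc : Continuous fun q : Fin N → ℝ => leftEnergy (pinnedChain ω₂ lam β γ) N b (q, fun _ => 0) :=
    (contDiff_leftEnergy (pinnedChain ω₂ lam β γ) (pinnedChain_contDiff_U ω₂ lam β γ (n := 1))
      (pinnedChain_contDiff_V ω₂ lam β γ (n := 1)) N b).continuous.comp (by fun_prop)
  refine ⟨integrable_mul_potWeight_of_le hω hl hβ hT hc (A := 2 * T) (fun q => ?_),
    integrable_mul_potWeight_of_le hω hl hβ hT (hc.pow 2) (A := 8 * T ^ 2) (fun q => ?_)⟩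
  · set u : ℝ := potEnergy ω₂ lam β N q / (2 * T) with hu
    have hU : potEnergy ω₂ lam β N q = 2 * T * u := by rw [hu]; field_simp
    have hue : u ≤ Real.exp u := by linarith [Real.add_one_le_exp u]
    rw [abs_of_nonneg (hE q).1]
    refine (hE q).2.trans ?_
    rw [hU]
    exact mul_le_mul_of_nonneg_left hue (by positivity)
  · set u : ℝ := potEnergy ω₂ lam β N q / (2 * T) with hu
    have hU : potEnergy ω₂ lam β N q = 2 * T * u := by rw [hu]; field_simp
    have hu0 : 0 ≤ u := by rw [hu]; exact div_nonneg (h0 q) (by positivity)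
    have h2 := Real.pow_div_factorial_le_exp u hu0 2
    rw [Nat.factorial_two, Nat.cast_ofNat, div_le_iff₀ (by norm_num : (0:ℝ) < 2)] at h2
    rw [abs_of_nonneg (sq_nonneg _)]
    have hsq : leftEnergy (pinnedChain ω₂ lam β γ) N b (q, fun _ => 0) ^ 2 ≤ potEnergy ω₂ lam β N q ^ 2 :=
      pow_le_pow_left₀ (hE q).1 (hE q).2 2
    refine hsq.trans ?_
    rw [hU]
    nlinarith [h2, sq_nonneg T]

/-- **Extensive position fluctuations of the block** (`q`-space Brascamp–Lieb for `f = U_{≤b}`):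
`∫ (U_{≤b} − m)² w ≤ (T/ω₂)·N·K₁·Z`, `m = (∫ U_{≤b} w)/Z`. [cite: BrascampLieb1976, Thm 4.1] -/
theorem leftPotFluct_le (hω : 0 < ω₂) (hl : 0 ≤ lam) (hβ : 0 ≤ β) (hT : 0 < T) (b : Fin N) :
    ∫ q, (leftEnergy (pinnedChain ω₂ lam β γ) N b (q, fun _ => 0) -
        (∫ q, leftEnergy (pinnedChain ω₂ lam β γ) N b (q, fun _ => 0) * potWeight ω₂ lam β T N q) /
          ∫ q, potWeight ω₂ lam β T N q) ^ 2 * potWeight ω₂ lam β T N q ≤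
      T / ω₂ * ((N : ℝ) * (3 * gradConst ω₂ lam β * (1 + T / ω₂ + 90 * (T / ω₂) ^ 3)) *
        ∫ q, potWeight ω₂ lam β T N q) := by
  obtain ⟨h1, h2⟩ := integrable_leftEnergy_zero_mul_potWeight (N := N) (γ := γ) hω hl hβ hT b
  obtain ⟨h3, hsum⟩ := integral_sum_sq_coordDeriv_leftEnergy_le (N := N) (γ := γ) hω hl hβ hT b
  have hcd : ContDiff ℝ 1 fun q : Fin N → ℝ => leftEnergy (pinnedChain ω₂ lam β γ) N b (q, fun _ => 0) :=
    (contDiff_leftEnergy (pinnedChain ω₂ lam β γ) (pinnedChain_contDiff_U ω₂ lam β γ (n := 1))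
      (pinnedChain_contDiff_V ω₂ lam β γ (n := 1)) N b).comp (by fun_prop)
  have key := potWeight_poincare hω hl hβ hT N
    (fun q : Fin N → ℝ => leftEnergy (pinnedChain ω₂ lam β γ) N b (q, fun _ => 0)) hcd h1 h2 h3
  exact key.trans (mul_le_mul_of_nonneg_left hsum (div_pos hT hω).le)

end BlockEnergyVariance

end Summit.AtomisticToContinuum.FouriersLaw.Theorems.BoundedResponse.ParityFloor

end
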